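import Summits.BirchSwinnertonDyer.BirchSwinnertonDyer.Theses.KatoDescentTamePotSupersingular
import Summits.BirchSwinnertonDyer.BirchSwinnertonDyer.Theorems.KatoDescentPotSupersingularReducibleKatoMemberZetaInputsDescent
import HarnessLib

/-!
# Route `KatoDescentTamePotSupersingular` (rung K8-t′, cell `bsd-potss`): the shared crux M `ReducibleKatoMember`
# (item stmt-BirchSwinnertonDyer-19196) from TWO held inputs — modularity and Kato's zeta-only member
# package — with NO Gross–Zagier–Kolyvagin (typed closers over the route-free node
# `ZetaInputsDescent.katoMemberShaBoundOfReducible_of_newform_of_zetaInputs`, seat `bsd-potss-rkm` g13)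

The live split (gen 2) of crux M on this route is `PublishedInputNewformKatoZT → PublishedInputMemberHullZetaInputsT
→ PublishedInputRankEqAnalyticRankZT → ReducibleKatoMember`, its glue `ReducibleKatoMemberOfZetaInputsT` closed
over rkm g10's 3-ary node.  The sibling route-free file
`KatoDescentPotSupersingularReducibleKatoMemberZetaInputsDescent.lean` (this seat) proves that the third
child is IDLE: Kato Thm. 14.5 (1) at the member (`finite_coinvariants_H2`) is a consequence of the zeta
package's own Thm. 12.5 (3) clause at the height-one prime `(γ − 1)` and Thm. 14.5 (2) — Kato's own
GZK-free road (Astérisque 295, 14.13–14.15).  This file states the consequence in the ROUTE's vocabulary: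

* `tameReducibleKatoMember_of_newformZT_of_zetaInputs : PublishedInputNewformKatoZT →
  PublishedInputMemberHullZetaInputsT → ReducibleKatoMember` (2-ary; the aliases unfold by `rfl`);
* (the live 3-ary glue decl — item 20300, closed by p528295 — is NOT re-proved here: a second proof of the same
  constant would be a `dedup.landed` restatement; its third binder is idle by the 2-ary theorem above).

For the planner (no edit made here): a `--resplit ReducibleKatoMember --children PublishedInputNewformKatoZT
PublishedInputMemberHullZetaInputsT --glue …` with k = 2 is closable by
`fun hN hZ => Theorems.tameReducibleKatoMember_of_newformZT_of_zetaInputs hN hZ`; or the gen-2 split stands with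
child 20298 documented idle.  HONEST FRAMING: conditional on the two named Literature facts (modularity;
Kato's zeta package = Thm. 12.5/12.6/13.10(1)/13.14/14.5(2)/14.16(2) + Wuthrich L.14 at the member, cite-level,
no `_holds` expected); the item is NOT closed by this file; nothing is booked; BSD is not advanced.

References: K. Kato, Astérisque 295 (2004), Thm. 12.5 (3) (p. 222), Thm. 14.5 (1)(2) (p. 236), 14.13–14.15,
(14.14.1)–(14.14.2) (p. 243), Prop. 14.16 (2) (p. 244) [Kato2004Asterisque]; C. Wuthrich, Doc. Math. 19 (2014)
Lemma 14 [Wuthrich2014]; F. Diamond, J. Shurman, GTM 228, Thm. 8.8.3 [DiamondShurman2005].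
-/

set_option autoImplicit false
-- sibling precedent (`KatoDescentTamePotSupersingularReducibleKatoMemberOfZetaInputs.lean`): the directory name
-- repeats the summit name
set_option linter.dupNamespace false

noncomputable section

namespace Summit.BirchSwinnertonDyer.BirchSwinnertonDyer.Theorems

open Literature.NumberTheory.EllipticCurves Literature.NumberTheory.EllipticCurves.ModularForms
  Literature.NumberTheory.EllipticCurves.Kato2004
open Summit.BirchSwinnertonDyer.BirchSwinnertonDyer.Theses.KatoDescentTamePotSupersingular

/-- **The K8-t′ crux `ReducibleKatoMember` (item stmt-BirchSwinnertonDyer-19196; conclusion = the route decl by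
name) from TWO held inputs**: `PublishedInputNewformKatoZT → PublishedInputMemberHullZetaInputsT →
ReducibleKatoMember` (modularity; Kato's zeta-only member package) — NO Gross–Zagier–Kolyvagin, by the
route-free node `ZetaInputsDescent.katoMemberShaBoundOfReducible_of_newform_of_zetaInputs` (the aliases and
the route decl unfold by `rfl` to the Literature constants and the node `O6.KatoMemberShaBoundOfReducible`).
Conditional on the two named facts; the item is not closed by this theorem.
[cite: Kato2004Asterisque, Thm. 12.5 (3) (p. 222), Thm. 14.5 (1)(2) (p. 236), §14.14 and Lemma 14.15 (pp. 243–244), Prop. 14.16 (2) (p. 244)]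
[cite: Wuthrich2014, Lemma 14 (p. 396)] [cite: DiamondShurman2005, Thm. 8.8.3] -/
theorem tameReducibleKatoMember_of_newformZT_of_zetaInputs (hN : PublishedInputNewformKatoZT)
    (hZ : PublishedInputMemberHullZetaInputsT) :
    Summit.BirchSwinnertonDyer.BirchSwinnertonDyer.Theses.KatoDescentTamePotSupersingular.ReducibleKatoMember :=
  ZetaInputsDescent.katoMemberShaBoundOfReducible_of_newform_of_zetaInputs hN hZ

/-- **Literature-constant form**: `exists_isNewformOf → Kato2004.exists_memberHullZetaInputs →
ReducibleKatoMember` (the same theorem with the aliases unfolded).  Conditional; nothing else assumed.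
[cite: Kato2004Asterisque, Thm. 12.5 (3) (p. 222), Thm. 14.5 (1)(2) (p. 236), Prop. 14.16 (2) (p. 244)]
[cite: Wuthrich2014, Lemma 14 (p. 396)] -/
theorem tameReducibleKatoMember_of_newform_of_memberHullZetaInputs (hmod : exists_isNewformOf)
    (hZ : Kato2004.exists_memberHullZetaInputs) :
    Summit.BirchSwinnertonDyer.BirchSwinnertonDyer.Theses.KatoDescentTamePotSupersingular.ReducibleKatoMember :=
  ZetaInputsDescent.katoMemberShaBoundOfReducible_of_newform_of_zetaInputs hmod hZ

end Summit.BirchSwinnertonDyer.BirchSwinnertonDyer.Theorems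

end
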